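import Mathlib.LinearAlgebra.Matrix.ToLin
import Mathlib.Data.Matrix.Basis
import Literature.AlgebraicGeometry.Motives.FaltingsECEndOfCoreProofs
import Literature.NumberTheory.EllipticCurves.TateModuleGaloisTransportProofs
import Literature.NumberTheory.EllipticCurves.TateModuleFixedPointsProofs
import Literature.NumberTheory.EllipticCurves.TateModuleFreeProofs
import Literature.NumberTheory.EllipticCurves.TateModuleFinrankProofs
import Literature.NumberTheory.EllipticCurves.IsogenyGeomEndRingCommProofs
import Literature.NumberTheory.GaloisRepresentations.ArtinRestriction
import HarnessLib

/-!
# No open subgroup of `Γ_K` acts on `V_ℓ E` by scalars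

Theorem-only `Proofs` companion of `Literature.AlgebraicGeometry.Motives.FaltingsECEndCore` (the
named fact `exists_eq_smul_one_of_equivariant_of_not_hasRationalCM W ℓ`, the residual core of
G. Faltings, *Endlichkeitssätze für abelsche Varietäten über Zahlkörpern*, Invent. Math. **73**
(1983), §5 Satz 4 for an elliptic curve `E` over a number field `K`; Engl. transl.
Cornell–Silverman, *Arithmetic Geometry* (1986), Ch. II §5 Theorem 4, held copy
`book:cornellnd-arithmetic-geometry`, PDF pp. 89–90).

It proves, for **every** elliptic curve `E = W` over a number field `K` and every prime `ℓ`: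

* `Literature.AlgebraicGeometry.Motives.false_of_forall_exists_eq_smul_one` — `Γ_K` does not act
  on `V_ℓ E` through scalars;
* `Literature.AlgebraicGeometry.Motives.exists_mem_not_exists_eq_smul_one_of_isOpen` — **no open
  subgroup `U ≤ Γ_K` acts on `V_ℓ E` through scalars**: some `σ ∈ U` has `ρ_ℓ(σ) ∉ ℚ_ℓ · 1`
  (equivalently, the image of `Γ_K` in `PGL(V_ℓ E)` is infinite).

This is the input, for curves with potential complex multiplication, of the proof of the core
fact in `FaltingsECEndCorePotentialCMProofs` (J.-P. Serre, *Abelian ℓ-adic representations and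
elliptic curves* (1968), Ch. IV §2.2, Remark: a curve with complex multiplication over `K̄` but
not over `K`).

## The proof

If `Γ_K` acts by scalars on `V_ℓ E`, every `ℚ_ℓ`-line is stable and every `ℤ_ℓ`-linear
endomorphism of `T_ℓ E` is `Γ_K`-equivariant (`T_ℓ E ↪ V_ℓ E`,
`TateModule.toRational_injective`). If `End_K(E) = ℤ` the first contradicts the irreducibility of
`V_ℓ E` (`finrank_ne_one_of_stable_of_not_hasRationalCM_of_numberField`, `FaltingsECEndOfCoreProofs`:
Shafarevich's theorem and Tate's line realization; Serre 1968, IV.2.1). If `E` has `K`-rational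
complex multiplication, Faltings' Satz 4 for `E` is a theorem of the tree
(`mem_span_range_tateEndRingHom_iff_of_hasRationalCM`, loc. cit.), so the second puts all of
`End_{ℤ_ℓ}(T_ℓ E) ≅ M₂(ℤ_ℓ)` inside the `ℤ_ℓ`-span of `T_ℓ(End_K(E))`, which is commutative
because `End_K(E) ⊆ End_{K̄}(E)` is (`WeierstrassCurve.geomEndRing_comm_holds`, *AEC* III.5.6(c))
— but the matrix units `E₁₂`, `E₂₁` do not commute. For an open subgroup `U`, pass to the fixed
field `L = K̄^U`, a number field: the image of the restriction `Γ_L → Γ_K`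
(`Literature.NumberTheory.GaloisRepresentations.absGaloisRestrict`) is a conjugate of `U`
(`exists_mem_range_absGaloisRestrict_fixedField_iff`, `ArtinRestriction`), and
`V_ℓ(E_L) ≅ V_ℓ(E)|_{Γ_L}` (`WeierstrassCurve.exists_rationalTateModule_equiv_baseChange`,
`TateModuleGaloisTransportProofs`), so `Γ_L` would act by scalars on `V_ℓ(E_L)`.

## References

* [Faltings1983Endlichkeit] G. Faltings, Invent. Math. 73 (1983), 349–366, §5 Satz 4; Engl.
  transl. in Cornell–Silverman (eds.), *Arithmetic Geometry* (1986), Ch. II §5 (held copy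
  `book:cornellnd-arithmetic-geometry`, PDF pp. 89–90; read).
* [Serre1968] J.-P. Serre, *Abelian ℓ-adic representations and elliptic curves*, Benjamin 1968,
  Ch. IV §2.1–2.2.
* [SilvermanAEC2009] J. H. Silverman, *The Arithmetic of Elliptic Curves*, 2nd ed., Cor. III.5.6(c),
  III.§7, Cor. IX.6.2.

## Design

Theorems only; `noncomputable section`; one universe `u`; base field `K : Type u` with
`[NumberField K] [W.IsElliptic]` as explicit instance hypotheses; "`ρ(σ)` is a scalar" is spelled
`∃ c : ℚ_[ℓ], rationalGaloisRepTate W ℓ σ = c • 1`, as in `FaltingsECEndCore`. The fixed field of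
the open subgroup is the intermediate field `IntermediateField.fixedField U` of `K̄/K`, read as a
number field through `NumberField.of_module_finite` (pattern of `ArtinRestriction`).
-/

noncomputable section

open scoped TensorProduct

universe u

namespace Literature.AlgebraicGeometry.Motives

open WeierstrassCurve Module Literature.NumberTheory.EllipticCurves
  Literature.NumberTheory.GaloisRepresentations

/-! ## Two pieces of algebra -/

/-- The `R`-span of a set of pairwise commuting elements of an `R`-algebra consists of pairwise
commuting elements.  DUPLICATE (dedup-00653) of the tree's `commute_of_mem_span_of_pairwise`
(`FaltingsECEndomorphismsProofs.lean`, same statement and context); kept only as a deprecated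
alias. [folklore] -/
@[deprecated (since := "2026-08-15")]
alias mul_comm_of_mem_span_of_forall_mul_comm := commute_of_mem_span_of_pairwise

/-- The endomorphism ring of a module with a basis of cardinality two is not commutative: the
matrix units `E₀₁`, `E₁₀` do not commute. [folklore] -/
theorem exists_mul_ne_mul_of_basis {R M : Type*} [CommRing R] [Nontrivial R] [AddCommGroup M]
    [Module R M] (b : Basis (Fin 2) R M) : ∃ f g : Module.End R M, f * g ≠ g * f := by
  classical
  refine ⟨Matrix.toLin b b (Matrix.single 0 1 1), Matrix.toLin b b (Matrix.single 1 0 1),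
    fun h ↦ ?_⟩
  have h' := congrArg (LinearMap.toMatrix b b) h
  rw [Module.End.mul_eq_comp, Module.End.mul_eq_comp, LinearMap.toMatrix_comp b b b,
    LinearMap.toMatrix_comp b b b, LinearMap.toMatrix_toLin, LinearMap.toMatrix_toLin,
    Matrix.single_mul_single_same, Matrix.single_mul_single_same] at h'
  have h00 := congrFun (congrFun h' 0) 0
  simp at h00

variable {K : Type u} [Field K] (W : WeierstrassCurve K) (ℓ : ℕ) [Fact ℓ.Prime]

/-! ## `Γ_K` does not act on `V_ℓ E` by scalars -/

/-- **`Γ_K` does not act on `V_ℓ E` through scalars.** For an elliptic curve `E = W` over a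
number field `K` and a prime `ℓ`, it is impossible that every `ρ_ℓ(σ)`, `σ ∈ Γ_K`, is a scalar on
`V_ℓ E`. If `End_K(E) = ℤ`, scalars stabilize every line, against the irreducibility of `V_ℓ E`
(Serre 1968, IV.2.1, the tree's `finrank_ne_one_of_stable_of_not_hasRationalCM_of_numberField`);
if `E` has `K`-rational complex multiplication, every endomorphism of `T_ℓ E` would be
`Γ_K`-equivariant, hence (Faltings' Satz 4 for `E`, the tree's
`mem_span_range_tateEndRingHom_iff_of_hasRationalCM`) in the `ℤ_ℓ`-span of `T_ℓ(End_K(E))`, which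
is commutative (*AEC* III.5.6(c), `WeierstrassCurve.geomEndRing_comm_holds`), whereas
`End(T_ℓ E) ≅ M₂(ℤ_ℓ)` is not. [cite: Serre1968, Ch. IV §2.1–2.2]
[cite: Faltings1983Endlichkeit, §5 Satz 4 (case of K-rational complex multiplication)] -/
theorem false_of_forall_exists_eq_smul_one [NumberField K] [W.IsElliptic]
    (h : ∀ σ : Field.absoluteGaloisGroup K, ∃ c : ℚ_[ℓ], rationalGaloisRepTate W ℓ σ = c • 1) :
    False := by
  have hℓK : ((ℓ : ℕ) : K) ≠ 0 := Nat.cast_ne_zero.mpr (Fact.out : ℓ.Prime).ne_zero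
  by_cases hCM : W.HasRationalCM
  · -- every endomorphism of `T_ℓ E` is equivariant, hence in the span of `T_ℓ(End_K(E))`
    have h4 := mem_span_range_tateEndRingHom_iff_of_hasRationalCM W ℓ hCM
    have hall : ∀ g : Module.End ℤ_[ℓ] (W.tateModule ℓ),
        g ∈ Submodule.span ℤ_[ℓ] (Set.range (tateEndRingHom W ℓ)) := by
      intro g
      rw [h4]
      intro σ x
      obtain ⟨c, hc⟩ := h σ
      -- `1 ⊗ g` on `V_ℓ E`, extending `g` along `T_ℓ E ↪ V_ℓ E`
      let G : Module.End ℚ_[ℓ] (W.rationalTateModule ℓ) := g.baseChange ℚ_[ℓ]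
      have key : ∀ y : W.tateModule ℓ,
          TateModule.toRational ℓ (g y) = G (TateModule.toRational ℓ y) := fun y ↦
        (LinearMap.baseChange_tmul (A := ℚ_[ℓ]) (f := g) 1 y).symm
      have hσ : ∀ y : W.tateModule ℓ,
          TateModule.toRational ℓ (σ • y) = c • TateModule.toRational ℓ y := fun y ↦ by
        rw [← rationalTateRepresentation_toRational]
        change rationalGaloisRepTate W ℓ σ _ = _
        rw [hc]
        rfl
      apply TateModule.toRational_injective (p := ℓ)
      calc TateModule.toRational ℓ (g (σ • x))
          = G (TateModule.toRational ℓ (σ • x)) := key _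
        _ = G (c • TateModule.toRational ℓ x) := by rw [hσ]
        _ = c • G (TateModule.toRational ℓ x) := G.map_smul c _
        _ = c • TateModule.toRational ℓ (g x) := by rw [← key]
        _ = TateModule.toRational ℓ (σ • g x) := (hσ (g x)).symm
    -- the span is commutative, `End(T_ℓ E)` is not
    have hcomm : ∀ a ∈ Set.range (tateEndRingHom W ℓ), ∀ b ∈ Set.range (tateEndRingHom W ℓ),
        a * b = b * a := by
      rintro _ ⟨φ, rfl⟩ _ ⟨ψ, rfl⟩
      rw [← map_mul, ← map_mul]
      congr 1
      exact Subtype.ext (geomEndRing_comm_holds W φ.1 ψ.1 (W.endRing_le_geomEndRing φ.2)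
        (W.endRing_le_geomEndRing ψ.2))
    haveI : Module.Free ℤ_[ℓ] (W.tateModule ℓ) := module_free_tateModule_holds W ℓ
    haveI : Module.Finite ℤ_[ℓ] (W.tateModule ℓ) := module_finite_tateModule_holds W ℓ
    obtain ⟨f, g, hfg⟩ := exists_mul_ne_mul_of_basis
      (Module.finBasisOfFinrankEq ℤ_[ℓ] (W.tateModule ℓ) (finrank_tateModule_eq_two_holds W ℓ hℓK))
    exact hfg (commute_of_mem_span_of_pairwise hcomm (hall f) (hall g))
  · -- `End_K(E) = ℤ`: scalars stabilize every line, but `V_ℓ E` is irreducible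
    obtain ⟨L₁, -, -, h₁, -⟩ := exists_three_lines (finrank_rationalTateModule_eq_two_holds W ℓ hℓK)
    refine finrank_ne_one_of_stable_of_not_hasRationalCM_of_numberField W ℓ hCM L₁
      (fun σ v hv ↦ ?_) h₁
    obtain ⟨c, hc⟩ := h σ
    rw [hc, LinearMap.smul_apply, Module.End.one_apply]
    exact L₁.smul_mem c hv

/-! ## No open subgroup of `Γ_K` acts on `V_ℓ E` by scalars -/

/-- **No open subgroup of `Γ_K` acts on `V_ℓ E` through scalars.** For an elliptic curve `E = W`
over a number field `K`, a prime `ℓ` and an open subgroup `U ≤ Γ_K`, some `σ ∈ U` acts on `V_ℓ E`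
by a non-scalar. Otherwise let `L = K̄^U`, a finite extension of `K` (`[L : K] = [Γ_K : U]`), hence
a number field; the restriction `Γ_L → Γ_K` has image a conjugate `g U g⁻¹` of `U`
(`exists_mem_range_absGaloisRestrict_fixedField_iff`), on which `ρ_ℓ` is again scalar, and
`V_ℓ(E_L) ≅ V_ℓ(E)|_{Γ_L}` (`WeierstrassCurve.exists_rationalTateModule_equiv_baseChange`), so
`Γ_L` would act on `V_ℓ(E_L)` through scalars, contradicting
`false_of_forall_exists_eq_smul_one` for the elliptic curve `E_L` over the number field `L`.
Equivalently: the image of `Γ_K` in `PGL(V_ℓ E)` is infinite. [cite: Serre1968, Ch. IV §2.1–2.2] -/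
theorem exists_mem_not_exists_eq_smul_one_of_isOpen [NumberField K] [W.IsElliptic]
    (U : Subgroup (Field.absoluteGaloisGroup K))
    (hU : IsOpen (U : Set (Field.absoluteGaloisGroup K))) :
    ∃ σ ∈ U, ¬ ∃ c : ℚ_[ℓ], rationalGaloisRepTate W ℓ σ = c • 1 := by
  by_contra hsc
  push Not at hsc
  -- the fixed field `L = K̄^U`, a number field, and the restriction `Γ_L → Γ_K`
  set L : IntermediateField K (AlgebraicClosure K) := IntermediateField.fixedField U with hL
  haveI : FiniteDimensional K L := finiteDimensional_fixedField_of_isOpen U hU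
  haveI : NumberField L := NumberField.of_module_finite K L
  obtain ⟨g, hg⟩ := exists_mem_range_absGaloisRestrict_fixedField_iff U hU
  -- `Γ_L` acts on `V_ℓ E` (through the restriction) by scalars
  have hres : ∀ γ : Field.absoluteGaloisGroup L, ∃ c : ℚ_[ℓ],
      rationalGaloisRepTate W ℓ (absGaloisRestrict K L γ) = c • 1 := by
    intro γ
    have hmem : g⁻¹ * absGaloisRestrict K L γ * g ∈ U := (hg _).mp ⟨γ, rfl⟩
    obtain ⟨c, hc⟩ := hsc _ hmem
    refine ⟨c, ?_⟩
    have e : absGaloisRestrict K L γ = g * (g⁻¹ * absGaloisRestrict K L γ * g) * g⁻¹ := by group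
    rw [e, map_mul, map_mul, hc, Algebra.mul_smul_comm, mul_one, Algebra.smul_mul_assoc, ← map_mul,
      mul_inv_cancel, map_one]
  -- hence on `V_ℓ(E_L) ≅ V_ℓ(E)|_{Γ_L}`
  obtain ⟨E, hE⟩ := W.exists_rationalTateModule_equiv_baseChange L ℓ
  refine false_of_forall_exists_eq_smul_one (W.baseChange L) ℓ fun γ ↦ ?_
  obtain ⟨c, hc⟩ := hres γ
  refine ⟨c, LinearMap.ext fun y ↦ ?_⟩
  obtain ⟨x, rfl⟩ := E.surjective y
  rw [← hE, hc, LinearMap.smul_apply, Module.End.one_apply, LinearMap.smul_apply,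
    Module.End.one_apply, map_smul]

/-- **Some element of every open subgroup acts by a non-scalar**, pointwise form: for an open
subgroup `U ≤ Γ_K` there is `σ ∈ U` such that `ρ_ℓ(σ) ≠ c · 1` for every `c ∈ ℚ_ℓ`.
[cite: Serre1968, Ch. IV §2.1–2.2] -/
theorem exists_mem_forall_ne_smul_one_of_isOpen [NumberField K] [W.IsElliptic]
    (U : Subgroup (Field.absoluteGaloisGroup K))
    (hU : IsOpen (U : Set (Field.absoluteGaloisGroup K))) :
    ∃ σ ∈ U, ∀ c : ℚ_[ℓ], rationalGaloisRepTate W ℓ σ ≠ c • 1 := by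
  obtain ⟨σ, hσU, hσ⟩ := exists_mem_not_exists_eq_smul_one_of_isOpen W ℓ U hU
  exact ⟨σ, hσU, fun c hc ↦ hσ ⟨c, hc⟩⟩

end Literature.AlgebraicGeometry.Motives
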